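import Mathlib
import HarnessLib
import HarnessLib.Audit
import Summits.HubbardSuperconductivity.Statement
import Literature.MathematicalPhysics.QuantumLattice.TorusPairSusceptibility

/-!
Route: CooperSharpness

DORMANT since 2026-09-03T09:43:27Z (reconciler: no traction for 5 d (last activity statement-checked at 2026-08-29T08:53:29Z); parked, not closed — `ledger route dormant route-HubbardSuperconductivity-CooperSharpness --off` to reactivat) — unstaffed, not closed; items shared with open routes are served there. `ledger route dormant <id> --off` reactivates.

# Route CooperSharpness — sharpness in the Cooper coordinate — a divergent torus pair susceptibility
at one repulsive-shifted local pair coupling forces linear growth of -1/log θ_L and a Kohn–Luttinger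
every-GS floor

It suffices to show X = COOPER-COORDINATE GROWTH (card cooper-coordinate-sharpness, item K1; decl
`CooperCoordinateGrowth`).
Embed the pure model as the interior point g = 0 of the LOCAL d-wave pair-coupling axis H_L(U,g) :=
hubbardTorus 2 L 1 U − g·K_L,
K_L := Σ_x P_xᴴP_x (P_x = localPair dWaveFormFactor L x, the singlet d_{x²−y²} pair at x; g < 0 =
local pair REPULSION; K_L conserves
N, S^z, momentum, D₄, so "(N_L, S^z=0)-sector ground state" keeps its meaning along the axis). For a
state ψ let θ_L(ψ) :=
L⁻⁴ Re⟨ψ, pFᴴpF ψ⟩ (pF = pairField dWaveFormFactor L = √2·Δ_d; the summit's order density, a-priori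
in [0, 32]) and the normalised
COOPER COORDINATE κ̃_L(ψ) := −1/log(θ_L(ψ)/64) ∈ [0, 1/log 2] (junk-free, increasing in θ). X: there
are U > 0, δ ∈ (0,1/2), g₀ < 0,
b > 0, a slack η_L → 0 and L₀ such that for every even L ≥ L₀ and all g₀ ≤ g₂ ≤ g₃ ≤ 0, for EVERY
normalised sector ground state ψ₃
of H_L(U,g₃) SOME normalised sector ground state ψ₂ of H_L(U,g₂) has κ̃_L(ψ₂) + b(g₃ − g₂) ≤
κ̃_L(ψ₃) + η_L — i.e. g ↦ (min-GS κ̃_L)(g) − b·g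
is non-decreasing on [g₀, 0] up to o(1): the transplant of the Aizenman–Barsky /
Duminil-Copin–Tassion mean-field bound
θ(p) ≥ c(p − p_c), with θ ↦ κ̃ (the one reparametrisation in which a BCS essential singularity obeys
an affine law; Osgood).
X is strictly stronger than S and decides it by one telescoping (GrowthGlue: κ̃_L(0) ≥ b|g₀| − η_L ⇒
θ_L(ψ) ≥ 64·e^{−2/(b|g₀|)} for every
ground state of the PURE model, every even L ≥ L₁) and the liminf bookkeeping (FloorGivesLRO).
Lean: `∃ U : ℝ, 0 < U ∧ ∃ δ ∈ Set.Ioo (0:ℝ) (1 / 2), ∃ g₀ : ℝ, g₀ < 0 ∧ ∃ b : ℝ, 0 < b ∧ ∃ η : ℕ →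
ℝ, Filter.Tendsto η Filter.atTop (nhds 0) ∧ ∃ L₀ : ℕ, ∀ (L : ℕ) [NeZero L], L₀ ≤ L → Even L → ∀ g₂
g₃ : ℝ, g₀ ≤ g₂ → g₂ ≤ g₃ → g₃ ≤ 0 → ∀ ψ₃ : Literature.MathematicalPhysics.QuantumLattice.Fock
(Literature.MathematicalPhysics.QuantumLattice.Orb
(Literature.MathematicalPhysics.QuantumLattice.FermionTorus 2 L)), star ψ₃ ⬝ᵥ ψ₃ = 1 →
Literature.MathematicalPhysics.QuantumLattice.IsGroundStateInSector
(Literature.MathematicalPhysics.QuantumLattice.hubbardTorus 2 L 1 U - ((g₃ : ℝ) : ℂ) • (∑ x :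
Literature.Probability.LatticeModels.TorusSite 2 L, Matrix.conjTranspose
(Literature.MathematicalPhysics.QuantumLattice.localPair
Literature.MathematicalPhysics.QuantumLattice.dWaveFormFactor L x) *
Literature.MathematicalPhysics.QuantumLattice.localPair
Literature.MathematicalPhysics.QuantumLattice.dWaveFormFactor L x)) (2 * ⌊(1 - δ) * (L : ℝ) ^ 2 /
2⌋₊) 0 ψ₃ → ∃ ψ₂ : Literature.MathematicalPhysics.QuantumLattice.Fock
(Literature.MathematicalPhysics.QuantumLattice.Orb
(Literature.MathematicalPhysics.QuantumLattice.FermionTorus 2 L)), star ψ₂ ⬝ᵥ ψ₂ = 1 ∧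
Literature.MathematicalPhysics.QuantumLattice.IsGroundStateInSector
(Literature.MathematicalPhysics.QuantumLattice.hubbardTorus 2 L 1 U - ((g₂ : ℝ) : ℂ) • (∑ x :
Literature.Probability.LatticeModels.TorusSite 2 L, Matrix.conjTranspose
(Literature.MathematicalPhysics.QuantumLattice.localPair
Literature.MathematicalPhysics.QuantumLattice.dWaveFormFactor L x) *
Literature.MathematicalPhysics.QuantumLattice.localPair
Literature.MathematicalPhysics.QuantumLattice.dWaveFormFactor L x)) (2 * ⌊(1 - δ) * (L : ℝ) ^ 2 /
2⌋₊) 0 ψ₂ ∧ (-1 / Real.log (((Literature.MathematicalPhysics.QuantumLattice.expect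
(Matrix.conjTranspose (Literature.MathematicalPhysics.QuantumLattice.pairField
Literature.MathematicalPhysics.QuantumLattice.dWaveFormFactor L) *
Literature.MathematicalPhysics.QuantumLattice.pairField
Literature.MathematicalPhysics.QuantumLattice.dWaveFormFactor L) ψ₂).re / (L : ℝ) ^ 4) / 64)) + b *
(g₃ - g₂) ≤ (-1 / Real.log (((Literature.MathematicalPhysics.QuantumLattice.expect
(Matrix.conjTranspose (Literature.MathematicalPhysics.QuantumLattice.pairField
Literature.MathematicalPhysics.QuantumLattice.dWaveFormFactor L) *
Literature.MathematicalPhysics.QuantumLattice.pairField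
Literature.MathematicalPhysics.QuantumLattice.dWaveFormFactor L) ψ₃).re / (L : ℝ) ^ 4) / 64)) + η L`

## Assembly
Pure logic, certified: `closes (h₁ : CooperCoordinateGrowth) (h₂ : GrowthGlue) (h₃ : FloorGivesLRO)
: HubbardSuperconductivity` —
h₁ gives (U, δ, g₀, b, η, L₀) and the growth law; h₂ turns it into the uniform floor m =
64·exp(2/(b·g₀)) > 0 for every ground state
of the pure model at every even L ≥ L₁; h₃ turns the floor into the summit matrix at (U, δ);
HubbardSuperconductivity ↔ ∃ U > 0,
∃ δ ∈ (0,1/2), matrix is `HubbardSuperconductivity_iff` (Iff.rfl). Four lines, rc 0 in the planner's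
Sketch.lean. The alternative
chain SharpnessDichotomy → CooperThreshold → CooperCoordinateGrowth is the support item
DichotomyGivesGrowth (also proved there).

Rationale: WHY THIS LINE. The card transplants the SHARPNESS dichotomy of percolation/Ising
(AizenmanBarsky1987, AizenmanBarskyFernandez1987, Menshikov1987,
DuminilCopinTassionCMP2016 = tree
`Literature.Probability.Percolation.DCT16_meanField_of_phi_ge_one`, proved there) to fermion pairing
with an explicit dictionary: p ↦ local d-wave pair coupling g; θ_n(p) ↦ min-GS order density θ_L;
Σ_xτ_p(0,x) ↦ torus pair
susceptibility per site χ_L/L² (LinHirschScalapino1988, tree `torusPairSusceptibility`); p_c ↦ the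
free Fermi gas (χ = ∞ by the Cooper
logarithm, θ = 0 — Shankar doi:10.1103/revmodphys.66.129), Kohn–Luttinger (KohnLuttinger1965,
RaghuKivelsonScalapino2010) reading "the
repulsive model is already supercritical, and so is some g₀ < 0"; Russo's formula ↦ Hellmann–Feynman
in g; the ABF/DCT one-sided
differential inequalities ↦ the two AFFINE laws of mean-field theory asked only as inequalities —
d(1/χ)/dg = −c_R (RPA, Riccati)
before the finite-size Cooper crossover and dκ̃/dg ≥ b (BCS: dΦ/dg = χ_ampΦ, κ' → N_d/2) after it.
Imported area: rigorous statistical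
mechanics of sharp phase transitions (differential inequalities / ODE comparison), with
finite-dimensional spectral perturbation theory
(Kato1966) for the susceptibility; no positivity (FKG/BK) is available for fermions, which is
exactly the open engine (crux
SharpnessDichotomy). What it does that prior routes do not: TorusCooperLog stops at the window's
edge with an ENERGY criterion;
DeformationLadder / KacWindowPenalty / KkFloor run on the MEAN-FIELD axis −(g/L²)pFᴴpF, where the
support item TwistAveragingBound
shows a per-site pair penalty is evaded by gauge twists at cost ≤ C√h·L, so g = 0 is an endpoint
there; here g = 0 is interior, the
flow is integrated to g = 0 at FINITE L and only then L → ∞ (no g→0⁺/L→∞ interchange, no anchor, no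
reflection positivity, no gap).

RANKED CRUXES. #0 CooperCoordinateGrowth (target) — X as in § Thesis (card K1, the (K)-law with
slack η_L → 0): at some U > 0, δ ∈ (0,1/2), g₀ < 0, with b > 0, for all large even L the min-GS
normalised Cooper coordinate κ̃_L = −1/log(θ_L/64) of H_L(U,g) = hubbardTorus 2 L 1 U − g·Σ_x
P_xᴴP_x grows at rate ≥ b along every subinterval of [g₀, 0], up to η_L. (why it might fail:
Strictly stronger than S: needs g_c(U,δ) < g₀ (KL pairing survives |g₀| of local d-pair repulsion),
no critical pair liquid on [g₀,0], and no persistent O(1) DOWNWARD jumps of the min-GS order at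
level crossings in g (η_L only absorbs o(1) jumps); b uniform on [g₀,0] forces L₀ ≳ ξ(g₀).)
[AizenmanBarsky1987, DuminilCopinTassionCMP2016, KohnLuttinger1965, RaghuKivelsonScalapino2010,
doi:10.1103/physrevb.75.235116, KomaTasaki1994]
#2 SharpnessDichotomy (crux) — THE TRANSPLANTED THEOREM (card K2+K3 recast composably;
Aizenman–Barsky "χ = ∞ ⇒ supercritical with a mean-field bound"): there are U₀ > 0, γ > 0 such that
for every U ∈ (0,U₀), δ ∈ (0,1/2), g₀ ∈ [−γ, 0): IF the full torus d-wave pair susceptibility per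
site of every normalised sector ground state of H_L(U,g₀) diverges along even L (∀X eventually
χ_L/L² ≥ X; `torusPairSusceptibility` with A = pairField dWaveFormFactor L, midpoint μ̄, reduced
resolvent), THEN the Cooper-coordinate growth law holds on [g₀/2, 0] with some b > 0, slack η_L → 0,
L₀. Intended proof = the card's two-clause scaffold (RC*): pre-crossover RICCATI dχ/dg ≥ c_Rχ² − C₀
("the Cooper ladder is a lower bound": divergence at g₀ explodes 1/χ within |g₀|/2), post-crossover
CONVEX clause dκ̃/dg ≥ b, hand-over at g₁(L) → g₀; both clauses are exact affine laws of RPA/BCS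
read one-sidedly. [difficulty: open-problem] (why it might fail: No fermionic Russo/BK engine is
known; a d-wave Bose metal / critical fan (χ=∞, no LRO on a g-interval), a χ-divergence driven by a
collapsing pair gap (phase separation) rather than pairing, or O(1) downward min-GS jumps at level
crossings would each break it at weak coupling.) [AizenmanBarsky1987, AizenmanBarskyFernandez1987,
AizenmanNewman1984, Menshikov1987, DuminilCopinTassionCMP2016, doi:10.1007/s10955-009-9788-z,
doi:10.1103/physrevb.75.235116, doi:10.1038/nature11732, LinHirschScalapino1988, Kato1966]
#3 CooperThreshold (crux) — KOHN–LUTTINGER SUPERCRITICALITY AT ONE REPULSIVE-SHIFTED COUPLING (card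
K3 (CL), divergence form): for every U₀ > 0 and γ > 0 there are U ∈ (0,U₀), δ ∈ (0,1/2) and g₀ ∈
[−γ, 0) such that the full torus d-wave pair susceptibility per site of EVERY normalised
(N_L,S^z=0)-sector ground state of H_L(U,g₀) = hubbardTorus 2 L 1 U − g₀·Σ_x P_xᴴP_x tends to +∞
along even L (∀ X ∃ L₁ ∀ even L ≥ L₁). Inside the window U·ℓ_L ≤ c₁ this is the finite-torus Cooper
log with net-attractive B1g channel (a_dU² − c_K|g₀| > 0; route TorusCooperLog, crux
CooperLogWindow); beyond it, "not a d-repulsive Fermi liquid" (card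
cooper-instability-no-symmetric-fermi-liquid as reductio) — in the ordered phase the coherent
(N±2)-ground-doublet term makes χ_L/L² ~ θ_L·L⁴ → ∞, at a critical point χ_L/L² → ∞ logarithmically.
[difficulty: open-problem] (why it might fail: |g_KL(U,δ)| ~ αU² may lie below every usable |g₀| at
tractable (U,δ); beyond L ≤ e^(c/U) nothing perturbative controls χ (WeakCouplingCeiling); a
d-repulsive Fermi liquid, an SDW/stripe or another KL channel condensing first keeps χ_d/L² bounded;
shell effects could make pairGap ≤ 0 at many L.) [KohnLuttinger1965, RaghuKivelsonScalapino2010,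
LinHirschScalapino1988, WhiteEtAl1989, BenfattoGiulianiMastropietro2006, DengEtAl2015,
Salmhofer1999, ArovasBergKivelsonRaghu2022]
#4 RiccatiWindow (crux) — THE PRE-CROSSOVER RICCATI CLAUSE IN THE CONVERGENT WINDOW, repaired rev 4
(route-repair after refuter-rattack-12972: rev-3 informal text refuted-MISSTATED, F1 vacuous window
/ F2 g=g′ rigidity / F3 open-shell χ̃ / F4 error ∝ main term): for every 0 < δ₁ ≤ δ₂ < 1/2 and κ > 0
there are U₀, c₁ > 0, C, L₀ such that for U ∈ [0,U₀), δ ∈ [δ₁,δ₂], even L ≥ L₀ with U·ℓ_L ≤ c₁ (ℓ_L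
= torusCooperSum L N_L 0), all g ≤ g′ ≤ 0 with |g|·ℓ_L ≤ c₁ and a pair-gapped base point κ/L² ≤
pairGap(H_L(U,g)) N_L: every normalised sector GS ψ′ of H_L(U,g′) admits a normalised sector GS ψ of
H_L(U,g) with χ̃(ψ) + ((g′−g)/4)·χ̃(ψ)χ̃(ψ′) ≤ χ̃(ψ′) + C, χ̃ = torusPairSusceptibility(H_L(U,·),
pairField dWave L, N_L, ·)/L² — the min-GS susceptibility dominates the Riccati flow at rate c_R/2 =
1/4 (ladder value c_R = 1/2: K_L ⊇ L⁻²pFᴴpF gives 1/χ̃(g) = 1/χ̃(0) − g/2 in RPA) up to an additive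
configuration slack C(κ). Calibration only: it cannot feed the Riccati clause's L → ∞ at fixed g₀
(the window caps ℓ_L ≤ c₁/|g₀|). [difficulty: L] (why it might fail: no T=0 finite-torus expansion
uniform in U·ℓ_L ≤ c₁ exists (BGM06 is T ≥ e^{-a/U}); Hartree–Fock orbit reoccupation (|g|, U² ≫
1/L²) needs a Fermi-surface counterterm on a discrete spectrum; configuration jumps of min-GS χ̃ may
beat any L-uniform C; rate 1/4 dies if vertex corrections are O(1).)
[BenfattoGiulianiMastropietro2006, FeldmanSalmhoferTrubowitz1996, FeldmanKnorrerTrubowitz2004,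
LinHirschScalapino1988, MatveevLarkin1997, Salmhofer1999, Kato1966, AizenmanNewman1984]
#9 DichotomyGivesGrowth (support) — the alternative deciding chain, pure logic (proved as `example`
in the planner's Sketch.lean): SharpnessDichotomy gives (U₀, γ); CooperThreshold at (U₀, γ) gives
(U, δ, g₀) with the divergence; SharpnessDichotomy returns b, η, L₀ and the growth law on [g₀/2, 0],
which is CooperCoordinateGrowth with g₀/2 < 0. [difficulty: provable-now] [AizenmanBarsky1987,
DuminilCopinTassionCMP2016]
#9 GrowthGlue (support) — ONE TELESCOPING (card P0; real-analysis core proved as `example`s in the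
planner's Sketch.lean): from the growth law at (U,δ,g₀,b,η,L₀) with g₀ < 0 < b, η_L → 0: for every
even L ≥ L₁ (L₁ ≥ L₀ with η_L ≤ b|g₀|/2) and every normalised sector ground state ψ of the PURE
model (= H_L(U,0): rewrite H − ((0:ℝ):ℂ)•K = H), take (g₂,g₃) = (g₀,0), ψ₃ = ψ: some GS ψ₂ at g₀ has
κ̃(ψ₂) + b|g₀| ≤ κ̃(ψ) + η_L; κ̃(ψ₂) ≥ 0 because θ(ψ₂) ∈ [0,32] (pFᴴpF ⪰ 0,
`pairField_conjTranspose_mul_self_posSemidef`; ‖pF‖² ≤ 32L⁴, `lroSeq_pairFieldCorr_le`) so log(θ/64)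
≤ 0; hence κ̃(ψ) ≥ b|g₀|/2 =: c > 0, so log(θ(ψ)/64) ∈ [−1/c, 0) and θ(ψ) ≥ 64·exp(−1/c) =
64·exp(2/(b·g₀)). [difficulty: provable-now] [DuminilCopinTassionCMP2016, Scalapino1995]
#9 FloorGivesLRO (support) — LIMINF BOOKKEEPING (pattern of Theorems/WeakCouplingBCSWcbcsThesis.lean
`hubbardSuperconductivity_of_evenThesis_half` / TorusCooperLog `PenaltyResponseLRO`): a uniform
floor m > 0 on the order density θ_L(ψ) = L⁻⁴Re⟨ψ,pFᴴpFψ⟩ of every normalised (N_L,S^z=0)-sector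
ground state of hubbardTorus 2 L 1 U at every even L ≥ L₀ implies the summit matrix at (U,δ): for
admissible (N,ψ) the LRO sequence at k ≥ max(L₀,2)/2 equals θ_{2k}(ψ(2k)) (`sum_torusPullback_succ`,
`torusLROSeq_pairFieldCorr_succ`), is eventually ≥ m and bounded by 32 (`lroSeq_pairFieldCorr_le`),
so its real liminf is ≥ m > 0 (`hasTorusLRO_of_eventually_le` pattern). [difficulty: provable-now]
[Scalapino1995, Griffiths1966, Tasaki2020]
#9 TwistAveragingBound (support) — WHY THE LOCAL AXIS (card P1; quantitative no-go for per-site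
mean-field pair penalties, provable now, serves kac-window-penalty-sandwich / KkFloor K2 /
DeformationLadder too): there is a universal C such that for all U, h ∈ (0,1], L ≥ L₀(h) and every
sector (N, S^z=0): E₀(hubbardTorus 2 L 1 U + (h/L²)·pFᴴpF) ≤ E₀(hubbardTorus 2 L 1 U) + C√h·L.
Proof: average the pure sector GS ψ over gauge twists U_q = exp(iΣ_x (q·x) n_x), q ∈ (2π/L)ℤ², |q|_∞
≤ ε (U_q preserves the sector; ±q averaging kills currents): kinetic excess ≤ 4ε²L²; U_qᴴ pF U_q =
pair field at momentum 2q, so Parseval over pair momenta gives avg_q⟨U_qψ, pFᴴpF U_qψ⟩ ≤ 4π²C₂L²/ε²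
(C₂ ≤ 128); penalty avg ≤ 4π²C₂h/ε²; optimise ε² = π√(C₂h)/L (needs εL ≥ 2π, i.e. L ≥ L₀(h)): excess
≤ 8π√C₂·√h·L. Corollary (Griffiths): no ground state of the h-penalised model has k=0 pair LRO for
any fixed h > 0 — an extensive penalty makes g = 0 an endpoint, hence the route's LOCAL coupling.
[difficulty: M] [KomaTasaki1994, Tasaki2019Tower, Griffiths1966, KaplanHorschVonDerLinden1989]

TWO-LAYER PLAN. Foreseen glued splits (nothing filed now): SharpnessDichotomy ⇐ RiccatiClause →
ConvexClause → SharpnessDichotomy, where RiccatiClause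
(pre-crossover, needs the definition regularTorusPairSusceptibility = torusPairSusceptibility with
the coherent (N∓2)-ground doublet
projected out, `(1 − eigenProj K (E + pairGap H N))`) is "∃ g₁(L) ∈ [g₀, g₀ + 1/(c_R·χ̃_L(g₀))]: for
g₀ ≤ g ≤ g' ≤ g₁ every GS obeys
1/χ̃_L(g') ≤ 1/χ̃_L(g) − c_R(g' − g)" and ConvexClause is the growth law on [g₁(L), 0] with the SAME
b (k = 2, glue = Riccati
comparison `RiccatiBlowupLemma`, pure real analysis); CooperThreshold ⇐ WindowDivergence
(RiccatiWindow below, perturbative) →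
NoSaturation (non-perturbative: χ_d/L² bounded along a subsequence ⇒ a d-repulsive Fermi-liquid
description ⇒ contradiction with the
certified B1g Kohn–Luttinger datum, cf. TorusCooperLog CertB1g) → CooperThreshold (k = 2). Rank-4
crux RiccatiWindow (filed informal after open, TYPED at rev 4 by route-repair, see RANKED CRUXES
#4): inside the window U·ℓ_L ≤ c₁, |g|·ℓ_L ≤ c₁ the one-sided RPA/Riccati chord of the min-GS torus
pair susceptibility at rate c_R/2 = 1/4 from every pair-gapped base point, with an additive
configuration slack (first provable theorem of the line; calibrates c_R = 1/2; sibling of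
TorusCooperLog's CooperLogWindow). Lesson recorded for the foreseen RiccatiClause split: it must be
typed in the same ∀ψ′∃ψ (min-GS), base-point-buffered, additive-slack form — on a finite torus the
full χ̃ spikes to O(1/(U+|g|)) at the ~|g|L² Hartree–Fock orbit crossings inside any g-interval, and
regularTorusPairSusceptibility (now landed) removes the coherent doublet of the ORDERED regime, not
these repulsive-side shell multiplets. If
SharpnessDichotomy and CooperThreshold close before the target, `route edit --closes-file` swaps the
deciding theorem to
closes' (h₂ h₃ hD hG hF) through DichotomyGivesGrowth.

KILL CRITERIA. (i) A C₄-symmetric 2D lattice-fermion family through the pure Hubbard line with a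
stable T = 0 phase of divergent uniform d-wave pair
susceptibility and NO pair LRO on an open g-interval at weak coupling (a d-wave Bose metal without
ring exchange,
doi:10.1103/physrevb.75.235116, doi:10.1038/nature11732) refutes SharpnessDichotomy ⇒ close
`refuted:SharpnessDichotomy` (the
dichotomy is the line). (ii) A theorem that for all small U and all δ ∈ (0,1/2) the d-wave torus
pair susceptibility per site of the
pure-plus-local-repulsion model stays bounded for every g₀ < 0 (KL attraction never beats any local
pair repulsion) refutes
CooperThreshold ⇒ pivot: restate the threshold AT g₀ = 0⁻ with an L-dependent coupling window, or
close. (iii) CooperCoordinateGrowth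
refuted-misstated by persistent downward min-GS jumps ⇒ restate with the ground-multiplet AVERAGE of
θ (the T → 0 limit of the thermal
state) in place of the min — new decl, same glue. (iv) S proved elsewhere at weak coupling
(WeakCouplingBCS / TorusCooperLog) moots the
target but not SharpnessDichotomy, which stays of independent interest.

NOT DECOMPOSED YET. The Riccati and convex clauses themselves (regularTorusPairSusceptibility has
landed, RegularTorusPairSusceptibility.lean; their constants c_R ≈ B1g Cooper-ladder coefficient,
b ≈ N_d/2·(1 + κ̃ log 64)⁻²); the hand-over lemma g₁(L) → g₀; the BCS/RPA CALIBRATION theorems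
(mean-field exactness of both affine laws
for the reduced d-wave BCS family hubbardTorus 2 L 1 0 − (g/L²)pFᴴpF, κ' → N_d/2, G − G₂ → N_d —
card P2; they validate the coordinate,
they are not load-bearing); the chord lemma on the mean-field axis; any quantitative (U, δ, g₀): aim
at δ ≈ 0.2–0.35, U ≤ 4 where
d_{x²−y²} leads (RaghuKivelsonScalapino2010 Fig. 2) and stripes do not intercept
(ArovasBergKivelsonRaghu2022 §5); ensemble and
open-shell bookkeeping inside RiccatiWindow (rev 4: intrinsic pair-gap buffer at the base point +
additive configuration slack; a non-emptiness lemma "closed isolated free shells are plentiful per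
doping window" may be filed as support if a refuter asks). All are layer-2 children or `--supports`
lemmas once a crux moves.

CHEAPEST FALSIFIER. Already run by the card's author (kit jobs j002720/j003152, ED of the √10×√10
torus, N = 8, U = 0,1,2,4,8, g ∈ [−2,3]): min-GS κ_L
monotone increasing on [−2, 0.5] at every U (slope 0.10–0.19 on [−0.5,0]), 1/χ_L affine before the
susceptibility peak (slope −2.0 ± 0.3)
— the Riccati-then-convex hand-over on the smallest torus with a d-wave form factor; queued 4×4 tori
(j002662, j002586) not yet read.
Next cheapest, decisive for the restated (slack) target: on the 4×4 and √18×√18, √20×√20 tori at δ ≈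
0.2–0.25, U = 2–4, scan
g ∈ [−0.5, 0] on a fine grid and record every GS level crossing with the JUMP of the min-GS θ_L: a
downward jump that does not shrink
with L kills CooperCoordinateGrowth as stated (kill criterion (iii) restatement); and DMRG on
width-6/8 cylinders: is −1/log θ
decreasing anywhere on [g₀, 0]? A literature kill: any published T = 0 phase with divergent uniform
d-wave pair susceptibility and no
LRO in a C₄-symmetric weak-coupling lattice-fermion model (searched: only ring-exchange / ladder
d-wave Bose metals).

NUMBERS. A-priori range θ_L ∈ [0, 32] (‖pF‖ ≤ 4√2·L²), so κ̃_L ∈ [0, 1/log 2]; floor delivered by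
the glue m = 64·e^(−2/(b|g₀|)); BCS
calibration (card, kit j002356, thermodynamic-limit d-wave BCS, t' = 0, n = 0.7/0.8/0.875/0.9):
N_d/2 = 0.46/0.67/0.90/1.01,
κ'(g ≈ 0.15) = 1.03/1.37/1.71/1.85, κ' > 0 for all g; 10-site ED slopes of κ_L on [−0.5, 0]:
0.14–0.19 (U ≤ 2), 0.13–0.17 (U = 4),
0.10–0.15 (U = 8); expected |g₀| ≈ |g_KL|/2 ~ αU²/2 and b ≈ N_d/2, i.e. the Kohn–Luttinger essential
singularity exp(−4/(N_dαU²))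
without expanding in U. TwistAveragingBound constants: kinetic 4ε²L², Parseval C₂ ≤ 128, C = 8π√C₂ ≈
284. Items at open: 8 (target,
2 typed cruxes, 4 supports, assembly) + crux RiccatiWindow (rank 4; filed informal after open, typed
at rev 4: ladder rate c_R = 1/2 in tree normalisation, certified one-sidedly as 1/4).

DEFINITION REQUESTS. regularTorusPairSusceptibility (Literature/MathematicalPhysics/QuantumLattice):
torusPairSusceptibility H A N ψ with the transition
vector (A + Aᴴ)ψ replaced by (1 − eigenProj K (E + pairGap H N))·(A + Aᴴ)ψ, K = H − μ̄N̂, E = E₀(N)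
− μ̄N — the REGULAR susceptibility of
the card (coherent ground doublet removed); LANDED (RegularTorusPairSusceptibility.lean); kept for
the foreseen RiccatiClause in the ordered regime — the repaired RiccatiWindow deliberately uses the
FULL susceptibility with a pair-gap buffer (pre-crossover with g < 0 the (N+2) ground state is not
the d-pair state, so the projection removes nothing relevant); not used by any item typed at open
(all
eight elaborate over existing declarations: hubbardTorus, localPair, pairField, dWaveFormFactor,
IsGroundStateInSector, expect,
torusPairSusceptibility, minEnergyOn, szSector, HasLongRangeOrder, halfOpenBox, torusPullback,
pairFieldCorr).

Novelty: Searches (2026-08-15, this seat): `lit search --hybrid "sharpness phase transition differential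
inequality susceptibility order parameter
quantum ground state"` (12 book hits, all generic: Oitmaa, Continentino, Landau–Binder — no
transplant); `lit search --source crossref
"sharpness phase transition differential inequality pairing susceptibility fermions"` (15:
AizenmanBarsky1987 itself, Muirhead 2024
Gaussian-field percolation, Beekenkamp compass/orthant models — nothing fermionic); `lit search
--source arxiv "sharpness phase
transition quantum Ising"` (15: arXiv:0901.0328 Björnberg–Grimmett the only rigorous quantum one);
`lit galaxy search "Aizenman-Barsky"
--star all` (2: Tasaki–Hara book, Heydenreich–van der Hofstad); `lit galaxy search "pair
susceptibility diverges" --star all` (2,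
irrelevant); `lit frontier HubbardSuperconductivity --since 2021` (30 descendants, none on
coupling-differential inequalities; nearest
arXiv:2601.18868 pair wave functions); grep of all 52 Theses headers of this sub for
sharpness|Aizenman|Riccati|differential inequalit
(only AizenmanEtAl2004 hard-core bosons); plus the card's own logged searches (crossref ×3, arXiv
×2, galaxy pdf "sharpness of the
phase transition" 30 hits: Takagi lectures, ABF, Björnberg thesis, Peled–Spinka — no fermion/BCS
transplant; OpenAlex 429 today).
Nearest prior art found: AizenmanBarsky1987 + AizenmanBarskyFernandez1987 +
DuminilCopinTassionCMP2016 (tree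
Literature.Probability.Percolation.DCT16_meanField_of_phi_ge_  [refs: 10.1007/s10955-009-9788-z, 0901.0328, 2601.18868, doi:10.1007/s10955-009-9788-z, AizenmanBarsky1987, AizenmanEtAl2004, AizenmanBarskyFernandez1987, DuminilCopinTassionCMP2016, AizenmanNewman1984]

Barriers (technique_class: sharpness-differential-inequality; riccati-comparison): - technique_class: sharpness-differential-inequality; riccati-comparison
- Literature.Barriers.HubbardSuperconductivity.WeakCouplingCeiling: evaded by the dichotomy (nothing
is expanded in U; the floor 64·e^(−2/(b|g₀|)) comes from INTEGRATING a one-sided inequality in the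
auxiliary coupling g at fixed U); it applies head-on to CooperThreshold beyond the window L ≤
e^(c/U) and is not evaded there — the bet is a reductio (bounded χ ⇒ d-repulsive Fermi liquid ⇒
contradiction with the B1g Kohn–Luttinger datum), not a convergent expansion below the Cooper scale.
- Literature.Barriers.HubbardSuperconductivity.PerturbativeInvisibilityOfPairing: evaded — the order
scale is an essential singularity produced by ODE comparison in κ̃ = −1/log(θ/64) (Osgood: the only
coordinate in which such an onset obeys a forcing inequality); no item reads a scale off a power
series in U.
- Literature.Barriers.HubbardSuperconductivity.LROForcesLowLyingStates: respected — every quantity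
is a min over the possibly degenerate sector ground space or a susceptibility of a ground state; no
gap, uniqueness or SSB ⇒ LRO transfer is used; the low-lying tower is exactly what makes χ_full
diverge in CooperThreshold (used as a resource).
- Literature.Barriers.HubbardSuperconductivity.GeneralizedHartreeFockNoPairing: not met —
quasi-free/BCS states only fix the SHAPE of the two affine laws (calibration), never a variational
bound for the pure model.
- Literature.Barriers.HubbardSuperconductivity.PositiveTemperature

History (route lifecycle, newest last):
- 2026-08-15T21:34:25Z · rev 4: restated RiccatiWindow (stmt-HubbardSuperconductivity-12972) — repair (route-repair seat): RiccatiWindow stmt-HubbardSuperconductivity-12972 refuted-MISSTATED by refuter-rattack-stmt-HubbardSuperconductivity-12972-0 (notes (planner-rrefute-HubbardSuperconductivity-Coope-eaef2309-0)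
- 2026-08-15T21:43:22Z · rev 5: restated RiccatiWindow (stmt-HubbardSuperconductivity-13894) — cone repair (route-repair seat planner-rrepair-HubbardSuperconductivity-Coope-8150a6c7-0): drop `import Literature.MathematicalPhysics.QuantumLattice.TorusCoope (planner-rrepair-HubbardSuperconductivity-Coope-8150a6c7-0)
- 2026-08-15T23:13:35Z · rev 6: restated RiccatiWindow (stmt-HubbardSuperconductivity-14072) — repair rev 6: RiccatiWindow stmt-HubbardSuperconductivity-14072 refuted-MISSTATED by refuter-rattack-stmt-HubbardSuperconductivity-14072-0 (upper point g′ unbuf (planner-rrefute-HubbardSuperconductivity-Coope-1b6a6799-0)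
- 2026-08-16T04:06:21Z · AUTO-CRUX (backfill): CooperCoordinateGrowth — hypotheses of the deciding theorem that nothing in the route derives are cruxes (operator:999:1085951)
- 2026-08-22T16:00:52Z · DORMANT — reconciler: no traction for 5.5 d (last activity statement-grounded at 2026-08-17T04:16:31Z); parked, not closed — `ledger route dormant route-HubbardSupercondu (operator:999:889941)
- 2026-08-29T08:51:08Z · REACTIVATED — reconciler: reactivated — activity statement-closed at 2026-08-29T07:51:59Z after parking at 2026-08-22T16:00:52Z (operator:999:966470)
- 2026-09-03T09:43:27Z · DORMANT — reconciler: no traction for 5 d (last activity statement-checked at 2026-08-29T08:53:29Z); parked, not closed — `ledger route dormant route-HubbardSuperconducti (operator:999:3937936)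

sub-problem: HubbardSuperconductivity · status: dormant · opened planner-plancard-HubbardSuperconductivity-Hub-26a64e98-0 2026-08-15T18:56:33Z · rev 7 · ledger route-HubbardSuperconductivity-CooperSharpness
GENERATED by the gate from the ledger (D-0016/17). Provers cite these decls: `theorem foo : Summit.HubbardSuperconductivity.HubbardSuperconductivity.Theses.CooperSharpness.<Decl> := …` in Summits/HubbardSuperconductivity/HubbardSuperconductivity/Theorems/<Name>.lean.
-/

namespace Summit.HubbardSuperconductivity.HubbardSuperconductivity.Theses.CooperSharpness

open scoped BigOperators Topology Manifold Classical MeasureTheory ProbabilityTheory Matrix InnerProductSpace ComplexConjugate ContinuousMap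
open Filter Set Function TopologicalSpace MeasureTheory

attribute [summit_statement] _root_.HubbardSuperconductivity

open Literature.Hubbard

/-- item stmt-HubbardSuperconductivity-12848 · crux (kind.auto-crux: conjecture-grade) · rank 0 · open · by planner
why it might fail: Strictly stronger than S: needs a KL-supercritical g₀<0 (d-pairing survives local d-pair repulsion |g₀|), no critical pair liquid on [g₀,0], no persistent O(1) DOWNWARD min-GS θ_L jumps at level crossings in g (η_L→0 absorbs o(1) only; no fermionic FKG); κ̃≤1/log2 caps b|g₀|; uniform b ⇒ L₀≳ξ(g₀).
sources: AizenmanBarsky1987, DuminilCopinTassionCMP2016, KohnLuttinger1965, RaghuKivelsonScalapino2010, MotrunichFisher2007, KomaTasaki1994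
[target] X as in § Thesis (card K1, the (K)-law with slack η_L → 0): at some U > 0, δ ∈ (0,1/2), g₀
< 0, with b > 0, for all large even L the min-GS normalised Cooper coordinate κ̃_L = −1/log(θ_L/64)
of H_L(U,g) = hubbardTorus 2 L 1 U − g·Σ_x P_xᴴP_x grows at rate ≥ b along every subinterval of [g₀,
0], up to η_L. -/
@[route_item "route-HubbardSuperconductivity-CooperSharpness"]
def CooperCoordinateGrowth : Prop :=
  ∃ U : ℝ, 0 < U ∧ ∃ δ ∈ Set.Ioo (0:ℝ) (1 / 2), ∃ g₀ : ℝ, g₀ < 0 ∧ ∃ b : ℝ, 0 < b ∧ ∃ η : ℕ → ℝ, Filter.Tendsto η Filter.atTop (nhds 0) ∧ ∃ L₀ : ℕ, ∀ (L : ℕ) [NeZero L], L₀ ≤ L → Even L → ∀ g₂ g₃ : ℝ, g₀ ≤ g₂ → g₂ ≤ g₃ → g₃ ≤ 0 → ∀ ψ₃ : Literature.MathematicalPhysics.QuantumLattice.Fock (Literature.MathematicalPhysics.QuantumLattice.Orb (Literature.MathematicalPhysics.QuantumLattice.FermionTorus 2 L)), star ψ₃ ⬝ᵥ ψ₃ =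 1 → Literature.MathematicalPhysics.QuantumLattice.IsGroundStateInSector (Literature.MathematicalPhysics.QuantumLattice.hubbardTorus 2 L 1 U - ((g₃ : ℝ) : ℂ) • (∑ x : Literature.Probability.LatticeModels.TorusSite 2 L, Matrix.conjTranspose (Literature.MathematicalPhysics.QuantumLattice.localPair Literature.MathematicalPhysics.QuantumLattice.dWaveFormFactor L x) * Literature.MathematicalPhysics.QuantumLattice.localPair Literature.MathematicalPhysics.QuantumLattice.dWaveFormFactor L x)) (2 * ⌊(1 - δ) * (L : ℝ) ^ 2 / 2⌋₊) 0 ψ₃ → ∃ ψ₂ : Literature.MathematicalPhysics.QuantumLattice.Fock (Literature.MathematicalPhysics.QuantumLattice.Orb (Literature.MathematicalPhysics.QuantumLattice.FermionTorus 2 L)), star ψ₂ ⬝ᵥ ψ₂ = 1 ∧ Literature.MathematicalPhysics.QuantumLattice.IsGroundStateInSector (Literature.MathematicalPhysics.QuantumLattice.hubbardTorus 2 L 1 U - ((g₂ : ℝ) : ℂ) • (∑ x : Literature.Probability.LatticeModels.TorusSite 2 L, Matrix.conjTranspose (Literature.MathematicalPhysics.QuantumLattice.localPair Literature.MathematicalPhysics.QuantumLattice.dWaveFormFactor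 L x) * Literature.MathematicalPhysics.QuantumLattice.localPair Literature.MathematicalPhysics.QuantumLattice.dWaveFormFactor L x)) (2 * ⌊(1 - δ) * (L : ℝ) ^ 2 / 2⌋₊) 0 ψ₂ ∧ (-1 / Real.log (((Literature.MathematicalPhysics.QuantumLattice.expect (Matrix.conjTranspose (Literature.MathematicalPhysics.QuantumLattice.pairField Literature.MathematicalPhysics.QuantumLattice.dWaveFormFactor L) * Literature.MathematicalPhysics.QuantumLattice.pairField Literature.MathematicalPhysics.QuantumLattice.dWaveFormFactor L) ψ₂).re / (L : ℝ) ^ 4) / 64)) + b * (g₃ - g₂) ≤ (-1 / Real.log (((Literature.MathematicalPhysics.QuantumLattice.expect (Matrix.conjTranspose (Literature.MathematicalPhysics.QuantumLattice.pairField Literature.MathematicalPhysics.QuantumLattice.dWaveFormFactor L) * Literature.MathematicalPhysics.QuantumLattice.pairField Literature.MathematicalPhysics.QuantumLattice.dWaveFormFactor L) ψ₃).re / (L : ℝ) ^ 4) / 64)) + η L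

/-- item stmt-HubbardSuperconductivity-12849 · crux · rank 2 · open · by planner
why it might fail: No fermionic Russo/BK/OSSS engine (quantum sharpness is proved only via FK/random-parity positivity, Björnberg–Grimmett 2009); b must be uniform for ALL δ∈(0,½), incl. χ-divergence from pairGap→0 (phase separation) or a d-wave Bose-metal fan (χ_d/L²→∞, θ_L→0 on a g-interval); O(1) min-GS jumps.
sources: AizenmanBarsky1987, AizenmanBarskyFernandez1987, DuminilCopinTassionCMP2016, doi:10.1007/s10955-009-9788-z, arXiv:0901.0328, MotrunichFisher2007
[crux] THE TRANSPLANTED THEOREM (card K2+K3 recast composably; Aizenman–Barsky "χ = ∞ ⇒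
supercritical with a mean-field bound"): there are U₀ > 0, γ > 0 such that for every U ∈ (0,U₀), δ ∈
(0,1/2), g₀ ∈ [−γ, 0): IF the full torus d-wave pair susceptibility per site of every normalised
sector ground state of H_L(U,g₀) diverges along even L (∀X eventually χ_L/L² ≥ X;
`torusPairSusceptibility` with A = pairField dWaveFormFactor L, midpoint μ̄, reduced resolvent),
THEN the Cooper-coordinate growth law holds on [g₀/2, 0] with some b > 0, slack η_L → 0, L₀.
Intended proof = the card's two-clause scaffold (RC*): pre-crossover RICCATI dχ/dg ≥ c_Rχ² − C₀
("the Cooper ladder is a lower bound": divergence at g₀ explodes 1/χ within |g₀|/2), post-crossover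
CONVEX clause dκ̃/dg ≥ b, hand-over at g₁(L) → g₀; both clauses are exact affine laws of RPA/BCS
read one-sidedly. [difficulty: open-problem] -/
@[route_item "route-HubbardSuperconductivity-CooperSharpness"]
def SharpnessDichotomy : Prop :=
  ∃ U₀ : ℝ, 0 < U₀ ∧ ∃ γ : ℝ, 0 < γ ∧ ∀ U ∈ Set.Ioo (0:ℝ) U₀, ∀ δ ∈ Set.Ioo (0:ℝ) (1 / 2), ∀ g₀ ∈ Set.Ico (-γ) (0:ℝ), (∀ X : ℝ, ∃ L₁ : ℕ, ∀ (L : ℕ) [NeZero L], L₁ ≤ L → Even L → ∀ ψ : Literature.MathematicalPhysics.QuantumLattice.Fock (Literature.MathematicalPhysics.QuantumLattice.Orb (Literature.MathematicalPhysics.QuantumLattice.FermionTorus 2 L)), star ψ ⬝ᵥ ψ = 1 → Literature.MathematicalPhysics.QuantumLattice.IsGroundStateInSector (Literature.MathematicalPhysics.QuantumLattice.hubbardTorus 2 L 1 U - ((g₀ : ℝ) : ℂ) • (∑ x : Literature.Probability.LatticeModels.TorusSite 2 L, Matrix.conjTranspose (Literature.MathematicalPhysics.QuantumLattice.localPair Literature.MathematicalPhysics.QuantumLattice.dWaveFormFactor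 L x) * Literature.MathematicalPhysics.QuantumLattice.localPair Literature.MathematicalPhysics.QuantumLattice.dWaveFormFactor L x)) (2 * ⌊(1 - δ) * (L : ℝ) ^ 2 / 2⌋₊) 0 ψ → X ≤ Literature.MathematicalPhysics.QuantumLattice.torusPairSusceptibility (Literature.MathematicalPhysics.QuantumLattice.hubbardTorus 2 L 1 U - ((g₀ : ℝ) : ℂ) • (∑ x : Literature.Probability.LatticeModels.TorusSite 2 L, Matrix.conjTranspose (Literature.MathematicalPhysics.QuantumLattice.localPair Literature.MathematicalPhysics.QuantumLattice.dWaveFormFactor L x) * Literature.MathematicalPhysics.QuantumLattice.localPair Literature.MathematicalPhysics.QuantumLattice.dWaveFormFactor L x)) (Literature.MathematicalPhysics.QuantumLattice.pairField Literature.MathematicalPhysics.QuantumLattice.dWaveFormFactor L) (2 * ⌊(1 - δ) * (L : ℝ) ^ 2 / 2⌋₊) ψ / (L : ℝ) ^ 2) → ∃ b : ℝ, 0 < b ∧ ∃ η : ℕ → ℝ, Filter.Tendsto η Filter.atTop (nhds 0) ∧ ∃ L₀ : ℕ, ∀ (L : ℕ) [NeZero L], L₀ ≤ L → Even L → ∀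 g₂ g₃ : ℝ, (g₀ / 2) ≤ g₂ → g₂ ≤ g₃ → g₃ ≤ 0 → ∀ ψ₃ : Literature.MathematicalPhysics.QuantumLattice.Fock (Literature.MathematicalPhysics.QuantumLattice.Orb (Literature.MathematicalPhysics.QuantumLattice.FermionTorus 2 L)), star ψ₃ ⬝ᵥ ψ₃ = 1 → Literature.MathematicalPhysics.QuantumLattice.IsGroundStateInSector (Literature.MathematicalPhysics.QuantumLattice.hubbardTorus 2 L 1 U - ((g₃ : ℝ) : ℂ) • (∑ x : Literature.Probability.LatticeModels.TorusSite 2 L, Matrix.conjTranspose (Literature.MathematicalPhysics.QuantumLattice.localPair Literature.MathematicalPhysics.QuantumLattice.dWaveFormFactor L x) * Literature.MathematicalPhysics.QuantumLattice.localPair Literature.MathematicalPhysics.QuantumLattice.dWaveFormFactor L x)) (2 * ⌊(1 - δ) * (L : ℝ) ^ 2 / 2⌋₊) 0 ψ₃ → ∃ ψ₂ : Literature.MathematicalPhysics.QuantumLattice.Fock (Literature.MathematicalPhysics.QuantumLattice.Orb (Literature.MathematicalPhysics.QuantumLattice.FermionTorus 2 L)), star ψ₂ ⬝ᵥ ψ₂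 = 1 ∧ Literature.MathematicalPhysics.QuantumLattice.IsGroundStateInSector (Literature.MathematicalPhysics.QuantumLattice.hubbardTorus 2 L 1 U - ((g₂ : ℝ) : ℂ) • (∑ x : Literature.Probability.LatticeModels.TorusSite 2 L, Matrix.conjTranspose (Literature.MathematicalPhysics.QuantumLattice.localPair Literature.MathematicalPhysics.QuantumLattice.dWaveFormFactor L x) * Literature.MathematicalPhysics.QuantumLattice.localPair Literature.MathematicalPhysics.QuantumLattice.dWaveFormFactor L x)) (2 * ⌊(1 - δ) * (L : ℝ) ^ 2 / 2⌋₊) 0 ψ₂ ∧ (-1 / Real.log (((Literature.MathematicalPhysics.QuantumLattice.expect (Matrix.conjTranspose (Literature.MathematicalPhysics.QuantumLattice.pairField Literature.MathematicalPhysics.QuantumLattice.dWaveFormFactor L) * Literature.MathematicalPhysics.QuantumLattice.pairField Literature.MathematicalPhysics.QuantumLattice.dWaveFormFactor L) ψ₂).re / (L : ℝ) ^ 4) / 64)) + b * (g₃ - g₂) ≤ (-1 / Real.log (((Literature.MathematicalPhysics.QuantumLattice.expect (Matrix.conjTranspose (Literature.MathematicalPhysics.QuantumLattice.pairField Literature.MathematicalPhysics.QuantumLattice.dWaveFormFactor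 L) * Literature.MathematicalPhysics.QuantumLattice.pairField Literature.MathematicalPhysics.QuantumLattice.dWaveFormFactor L) ψ₃).re / (L : ℝ) ^ 4) / 64)) + η L

/-- item stmt-HubbardSuperconductivity-12850 · crux · rank 3 · open · by planner
why it might fail: Every-GS divergence at ALL large even L needs sign control of pairGap_L on open shells (1st order in U the sector energy is affine in shell filling: pairGap=O((|g₀|+U²)/L²), sign open; pairGap<0 i.o. sinks ∀L≥L₁ via negative coherent terms); beyond L≲e^{a/U} (BGM06: T≥e^{−a/|U|}) nothing controls χ.
sources: KohnLuttinger1965, RaghuKivelsonScalapino2010, BenfattoGiulianiMastropietro2006, arXiv:cond-mat/0507686, DengEtAl2015, SimkovicEtAl2016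
[crux] KOHN–LUTTINGER SUPERCRITICALITY AT ONE REPULSIVE-SHIFTED COUPLING (card K3 (CL), divergence
form): for every U₀ > 0 and γ > 0 there are U ∈ (0,U₀), δ ∈ (0,1/2) and g₀ ∈ [−γ, 0) such that the
full torus d-wave pair susceptibility per site of EVERY normalised (N_L,S^z=0)-sector ground state
of H_L(U,g₀) = hubbardTorus 2 L 1 U − g₀·Σ_x P_xᴴP_x tends to +∞ along even L (∀ X ∃ L₁ ∀ even L ≥
L₁). Inside the window U·ℓ_L ≤ c₁ this is the finite-torus Cooper log with net-attractive B1g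
channel (a_dU² − c_K|g₀| > 0; route TorusCooperLog, crux CooperLogWindow); beyond it, "not a
d-repulsive Fermi liquid" (card cooper-instability-no-symmetric-fermi-liquid as reductio) — in the
ordered phase the coherent (N±2)-ground-doublet term makes χ_L/L² ~ θ_L·L⁴ → ∞, at a critical point
χ_L/L² → ∞ logarithmically. [difficulty: open-problem] -/
@[route_item "route-HubbardSuperconductivity-CooperSharpness"]
def CooperThreshold : Prop :=
  ∀ U₀ : ℝ, 0 < U₀ → ∀ γ : ℝ, 0 < γ → ∃ U ∈ Set.Ioo (0:ℝ) U₀, ∃ δ ∈ Set.Ioo (0:ℝ) (1 / 2), ∃ g₀ ∈ Set.Ico (-γ) (0:ℝ), ∀ X : ℝ, ∃ L₁ : ℕ, ∀ (L : ℕ) [NeZero L], L₁ ≤ L → Even L → ∀ ψ : Literature.MathematicalPhysics.QuantumLattice.Fock (Literature.MathematicalPhysics.QuantumLattice.Orb (Literature.MathematicalPhysics.QuantumLattice.FermionTorus 2 L)), star ψ ⬝ᵥ ψ = 1 → Literature.MathematicalPhysics.QuantumLattice.IsGroundStateInSector (Literature.MathematicalPhysics.QuantumLattice.hubbardTorus 2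 L 1 U - ((g₀ : ℝ) : ℂ) • (∑ x : Literature.Probability.LatticeModels.TorusSite 2 L, Matrix.conjTranspose (Literature.MathematicalPhysics.QuantumLattice.localPair Literature.MathematicalPhysics.QuantumLattice.dWaveFormFactor L x) * Literature.MathematicalPhysics.QuantumLattice.localPair Literature.MathematicalPhysics.QuantumLattice.dWaveFormFactor L x)) (2 * ⌊(1 - δ) * (L : ℝ) ^ 2 / 2⌋₊) 0 ψ → X ≤ Literature.MathematicalPhysics.QuantumLattice.torusPairSusceptibility (Literature.MathematicalPhysics.QuantumLattice.hubbardTorus 2 L 1 U - ((g₀ : ℝ) : ℂ) • (∑ x : Literature.Probability.LatticeModels.TorusSite 2 L, Matrix.conjTranspose (Literature.MathematicalPhysics.QuantumLattice.localPair Literature.MathematicalPhysics.QuantumLattice.dWaveFormFactor L x) * Literature.MathematicalPhysics.QuantumLattice.localPair Literature.MathematicalPhysics.QuantumLattice.dWaveFormFactor L x)) (Literature.MathematicalPhysics.QuantumLattice.pairField Literature.MathematicalPhysics.QuantumLattice.dWaveFormFactor L) (2 * ⌊(1 - δ) * (L : ℝ) ^ 2 / 2⌋₊) ψ / (L : ℝ)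 ^ 2

-- earlier RiccatiWindow (stmt-HubbardSuperconductivity-12972, replaced 2026-08-15T21:34:25Z -> stmt-HubbardSuperconductivity-13894): retired by None — [crux] RiccatiWindow (rank 4; card cooper-coordinate-sharpness, the pre-crossover RICCATI clause of the scaffold (RC*) restricted to the convergent window — first provable theorem of the line, calibrates c_R; sibling of TorusCooperLog's CooperLogWindo
-- earlier RiccatiWindow (stmt-HubbardSuperconductivity-13894, replaced 2026-08-15T21:43:22Z -> stmt-HubbardSuperconductivity-14072): retired by None — ∀ δ₁ δ₂ : ℝ, 0 < δ₁ → δ₁ ≤ δ₂ → δ₂ < 1 / 2 → ∀ κ : ℝ, 0 < κ → ∃ U₀ : ℝ, 0 < U₀ ∧ ∃ c₁ : ℝ, 0 < c₁ ∧ ∃ C : ℝ, ∃ L₀ : ℕ, ∀ U ∈ Set.Ico (0:ℝ) U₀, ∀ δ ∈ Set.Icc δ₁ δ₂, ∀ (L : ℕ) [NeZero L], L₀ ≤ L → Even L → ∀ N : ℕ, N = 2 * ⌊(1 - δ) * (L : ℝ) ^ 2 / 2⌋₊ →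
-- earlier RiccatiWindow (stmt-HubbardSuperconductivity-14072, replaced 2026-08-15T23:13:35Z -> stmt-HubbardSuperconductivity-13924): retired by None — ∀ δ₁ δ₂ : ℝ, 0 < δ₁ → δ₁ ≤ δ₂ → δ₂ < 1 / 2 → ∀ κ : ℝ, 0 < κ → ∃ U₀ : ℝ, 0 < U₀ ∧ ∃ c₁ : ℝ, 0 < c₁ ∧ ∃ C : ℝ, ∃ L₀ : ℕ, ∀ U ∈ Set.Ico (0:ℝ) U₀, ∀ δ ∈ Set.Icc δ₁ δ₂, ∀ (L : ℕ) [NeZero L], L₀ ≤ L → Even L → ∀ N : ℕ, N = 2 * ⌊(1 - δ) * (L : ℝ) ^ 2 / 2⌋₊ →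
/-- item stmt-HubbardSuperconductivity-13924 · crux · rank 4 · open · by planner
why it might fail: No T=0 finite-torus expansion uniform in U·ℓ_L≤c₁ exists (BGM06: T≥e^{-a/U}); HF reoccupation (|g|,U²≫1/L²) needs a Fermi-surface counterterm on a discrete spectrum; near-shell weight/κ at buffered points may beat any L-uniform C; rate 1/4 dies if vertex corrections are O(1)
sources: BenfattoGiulianiMastropietro2006, FeldmanSalmhoferTrubowitz1996, FeldmanKnorrerTrubowitz2004, LinHirschScalapino1988, MatveevLarkin1997, Salmhofer1999
[crux] RiccatiWindow rev 6 (route-repair after refuter-rattack-stmt-HubbardSuperconductivity-14072-0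
refuted rev 5 as MISSTATED; evidence EVIDENCE.md, pt2_results.md on stmt-14072): rev 5 + ONE
hypothesis, the UPPER-POINT pair-gap buffer κ/L² ≤ pairGap(H_L(U,g′)) N_L (the refuter's repair C′;
certificate riccatiWindowR_of_riccatiWindow : rev 5 → rev 6, Sketch.lean rc 0 — only a hypothesis is
added). WHY: rev 5 buffered the base point g only, but the chord evaluates the FULL χ̃ at g′, whose
lowest (N±2) denominators equal pairGap(H g′) (minEnergyOn_add/sub_two_sub_eq_pairGap); so
χ̃_{g′}(ψ′) → −∞ as pairGap(H g′) ↑ 0⁻ with non-zero coherent pair weight (Lemma A) and the chord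
secretly asserted 'pairGap(H g′) ≥ 0 along every window sweep' (Cor. B) — false in PT: pairGap is
first-order FLAT at 4↔8 orbit crossings (Lemma C) and 2nd-order NEGATIVE at the 8+2 union shell of
the 6×6 torus, δ = 0.22. With the two-sided buffer both χ̃(ψ) and χ̃(ψ′) are honest non-negative
spectral sums (torusPairSusceptibility_nonneg), nothing is truncated by x/0 = 0, and the witness Δ′
↑ 0⁻ is excluded. WHY NOT the whole-segment buffer ∀ g″ ∈ [g,g′] (refuter g46-0's variant): in the
window the HF self-ener -/
@[route_item "route-HubbardSuperconductivity-CooperSharpness"]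
def RiccatiWindow : Prop :=
  ∀ δ₁ δ₂ : ℝ, 0 < δ₁ → δ₁ ≤ δ₂ → δ₂ < 1 / 2 → ∀ κ : ℝ, 0 < κ → ∃ U₀ : ℝ, 0 < U₀ ∧ ∃ c₁ : ℝ, 0 < c₁ ∧ ∃ C : ℝ, ∃ L₀ : ℕ, ∀ U ∈ Set.Ico (0:ℝ) U₀, ∀ δ ∈ Set.Icc δ₁ δ₂, ∀ (L : ℕ) [NeZero L], L₀ ≤ L → Even L → ∀ N : ℕ, N = 2 * ⌊(1 - δ) * (L : ℝ) ^ 2 / 2⌋₊ → ∀ ε : Literature.Probability.LatticeModels.TorusSite 2 L → ℝ, (∀ k, ε k = -2 * ∑ i : Fin 2, Real.cos (Literature.Probability.LatticeModels.latticeMomentum L k i)) → ∀ μ : ℝ, μ = sInf {E : ℝ | N ≤ 2 * (Finset.univ.filter (fun k : Literature.Probability.LatticeModels.TorusSite 2 L => ε k ≤ E)).card} → ∀ ℓ : ℝ, ℓ = ((L : ℝ) ^ 2)⁻¹ * (∑ k ∈ Finset.univ.filter (fun k : Literature.Probability.LatticeModels.TorusSite 2 L => 0 < |ε k - μ|), 1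 / (2 * |ε k - μ|)) → ∀ H : ℝ → Matrix (Finset (Literature.MathematicalPhysics.QuantumLattice.Orb (Literature.MathematicalPhysics.QuantumLattice.FermionTorus 2 L))) (Finset (Literature.MathematicalPhysics.QuantumLattice.Orb (Literature.MathematicalPhysics.QuantumLattice.FermionTorus 2 L))) ℂ, (∀ g : ℝ, H g = Literature.MathematicalPhysics.QuantumLattice.hubbardTorus 2 L 1 U - ((g : ℝ) : ℂ) • ∑ x : Literature.Probability.LatticeModels.TorusSite 2 L, Matrix.conjTranspose (Literature.MathematicalPhysics.QuantumLattice.localPair Literature.MathematicalPhysics.QuantumLattice.dWaveFormFactor L x) * Literature.MathematicalPhysics.QuantumLattice.localPair Literature.MathematicalPhysics.QuantumLattice.dWaveFormFactor L x) → ∀ χ : ℝ → Literature.MathematicalPhysics.QuantumLattice.Fock (Literature.MathematicalPhysics.QuantumLattice.Orb (Literature.MathematicalPhysics.QuantumLattice.FermionTorus 2 L)) → ℝ, (∀ (g : ℝ) (ψ : Literature.MathematicalPhysics.QuantumLattice.Fock (Literature.MathematicalPhysics.QuantumLattice.Orb (Literature.MathematicalPhysics.QuantumLattice.FermionTorus 2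 L))), χ g ψ = Literature.MathematicalPhysics.QuantumLattice.torusPairSusceptibility (H g) (Literature.MathematicalPhysics.QuantumLattice.pairField Literature.MathematicalPhysics.QuantumLattice.dWaveFormFactor L) N ψ / (L : ℝ) ^ 2) → U * ℓ ≤ c₁ → ∀ g g' : ℝ, g ≤ g' → g' ≤ 0 → -g * ℓ ≤ c₁ → κ / (L : ℝ) ^ 2 ≤ Literature.MathematicalPhysics.QuantumLattice.pairGap (H g) N → κ / (L : ℝ) ^ 2 ≤ Literature.MathematicalPhysics.QuantumLattice.pairGap (H g') N → ∀ ψ' : Literature.MathematicalPhysics.QuantumLattice.Fock (Literature.MathematicalPhysics.QuantumLattice.Orb (Literature.MathematicalPhysics.QuantumLattice.FermionTorus 2 L)), star ψ' ⬝ᵥ ψ' = 1 → Literature.MathematicalPhysics.QuantumLattice.IsGroundStateInSector (H g') N 0 ψ' → ∃ ψ : Literature.MathematicalPhysics.QuantumLattice.Fock (Literature.MathematicalPhysics.QuantumLattice.Orb (Literature.MathematicalPhysics.QuantumLattice.FermionTorus 2 L)), star ψ ⬝ᵥ ψ = 1 ∧ Literature.MathematicalPhysics.QuantumLattice.IsGroundStateInSector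 (H g) N 0 ψ ∧ χ g ψ + (g' - g) / 4 * χ g ψ * χ g' ψ' ≤ χ g' ψ' + C

/-- item stmt-HubbardSuperconductivity-19057 · crux · rank 5 · open · by planner
why it might fail: No fermionic sharpness engine (no FKG/BK/OSSS); a d-wave Bose-metal fan (χ_d/L²→∞ but θ_L→0 on a g-interval, Motrunich–Fisher) or a competing order (stripe / other KL channel) condensing between g₀ and 0 breaks it; 'every GS' fails if a ground multiplet splits θ by ≫1/L.
sources: AizenmanBarsky1987, DuminilCopinTassionCMP2016, MotrunichFisher2007, KomaTasaki1994, RaghuKivelsonScalapino2010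
[crux] INCIPIENT-ORDER PROPAGATION — sharpness in weak form (crux-strategist split of
CooperCoordinateGrowth, piece R): at weak coupling (∃U₀,γ; ∀U∈(0,U₀), δ∈(0,1/2), g₀∈[−γ,0)), IF the
torus d-wave pair susceptibility per site of EVERY normalised (N_L,S^z=0)-sector ground state of
H_L(U,g₀) = hubbardTorus 2 L 1 U − g₀·Σ_x P_xᴴP_x diverges along even L (the antecedent of
SharpnessDichotomy = the conclusion of CooperThreshold, verbatim), THEN for every Δ>0, all large
even L and every coupling g∈[g₀+Δ,0], EVERY normalised sector ground state ψ of H_L(U,g) has order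
density θ_L(ψ) = L⁻⁴Re⟨ψ,pFᴴpF ψ⟩ ≥ 1/L — no intermediate phase to the right of a
divergent-susceptibility coupling (transplant of Aizenman–Barsky p_T = p_H / Duminil-Copin–Tassion;
conclusion junk-free: only the order density appears, no susceptibility at intermediate couplings,
no pair-gap sign clause). Any mesoscopic threshold L⁻²log L ≪ t_L ≪ 1 separates the normal value θ_L
~ L⁻²log L from order; t_L = 1/L is fixed so that R feeds LocalConvexStep. Assembly:
Theorems-candidate CooperSharpnessCooperCoordinateGrowthSplit.lean (evidence on stmt-12848; rc0, 0
sorry). (why it might fail: No fermionic sharpness engine (no FK -/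
@[route_item "route-HubbardSuperconductivity-CooperSharpness"]
def IncipientOrderPropagation : Prop :=
  ∃ U₀ : ℝ, 0 < U₀ ∧ ∃ γ : ℝ, 0 < γ ∧ ∀ U ∈ Set.Ioo (0:ℝ) U₀, ∀ δ ∈ Set.Ioo (0:ℝ) (1 / 2), ∀ g₀ ∈ Set.Ico (-γ) (0:ℝ), (∀ X : ℝ, ∃ L₁ : ℕ, ∀ (L : ℕ) [NeZero L], L₁ ≤ L → Even L → ∀ ψ : Literature.MathematicalPhysics.QuantumLattice.Fock (Literature.MathematicalPhysics.QuantumLattice.Orb (Literature.MathematicalPhysics.QuantumLattice.FermionTorus 2 L)), star ψ ⬝ᵥ ψ = 1 → Literature.MathematicalPhysics.QuantumLattice.IsGroundStateInSector (Literature.MathematicalPhysics.QuantumLattice.hubbardTorus 2 L 1 U - ((g₀ : ℝ) : ℂ) • (∑ x : Literature.Probability.LatticeModels.TorusSite 2 L, Matrix.conjTranspose (Literature.MathematicalPhysics.QuantumLattice.localPair Literature.MathematicalPhysics.QuantumLattice.dWaveFormFactor L x) * Literature.MathematicalPhysics.QuantumLattice.localPair Literature.MathematicalPhysics.QuantumLattice.dWaveFormFactor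 L x)) (2 * ⌊(1 - δ) * (L : ℝ) ^ 2 / 2⌋₊) 0 ψ → X ≤ Literature.MathematicalPhysics.QuantumLattice.torusPairSusceptibility (Literature.MathematicalPhysics.QuantumLattice.hubbardTorus 2 L 1 U - ((g₀ : ℝ) : ℂ) • (∑ x : Literature.Probability.LatticeModels.TorusSite 2 L, Matrix.conjTranspose (Literature.MathematicalPhysics.QuantumLattice.localPair Literature.MathematicalPhysics.QuantumLattice.dWaveFormFactor L x) * Literature.MathematicalPhysics.QuantumLattice.localPair Literature.MathematicalPhysics.QuantumLattice.dWaveFormFactor L x)) (Literature.MathematicalPhysics.QuantumLattice.pairField Literature.MathematicalPhysics.QuantumLattice.dWaveFormFactor L) (2 * ⌊(1 - δ) * (L : ℝ) ^ 2 / 2⌋₊) ψ / (L : ℝ) ^ 2) → ∀ Δ : ℝ, 0 < Δ → ∃ L₁ : ℕ, ∀ (L : ℕ) [NeZero L], L₁ ≤ L → Even L → ∀ g : ℝ, g₀ + Δ ≤ g → g ≤ 0 → ∀ ψ : Literature.MathematicalPhysics.QuantumLattice.Fock (Literature.MathematicalPhysics.QuantumLattice.Orb (Literature.MathematicalPhysics.QuantumLattice.FermionTorus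 2 L)), star ψ ⬝ᵥ ψ = 1 → Literature.MathematicalPhysics.QuantumLattice.IsGroundStateInSector (Literature.MathematicalPhysics.QuantumLattice.hubbardTorus 2 L 1 U - ((g : ℝ) : ℂ) • (∑ x : Literature.Probability.LatticeModels.TorusSite 2 L, Matrix.conjTranspose (Literature.MathematicalPhysics.QuantumLattice.localPair Literature.MathematicalPhysics.QuantumLattice.dWaveFormFactor L x) * Literature.MathematicalPhysics.QuantumLattice.localPair Literature.MathematicalPhysics.QuantumLattice.dWaveFormFactor L x)) (2 * ⌊(1 - δ) * (L : ℝ) ^ 2 / 2⌋₊) 0 ψ → 1 / (L : ℝ) ≤ ((Literature.MathematicalPhysics.QuantumLattice.expect (Matrix.conjTranspose (Literature.MathematicalPhysics.QuantumLattice.pairField Literature.MathematicalPhysics.QuantumLattice.dWaveFormFactor L) * Literature.MathematicalPhysics.QuantumLattice.pairField Literature.MathematicalPhysics.QuantumLattice.dWaveFormFactor L) ψ).re / (L : ℝ) ^ 4)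

/-- item stmt-HubbardSuperconductivity-19058 · crux · rank 6 · open · by planner
why it might fail: dκ̃/dg ≥ b is BCS mean-field (κ̃≈N_d·g_net/2); beyond it κ̃ may plateau on part of [−γ,0] (b not uniform); in the finite-size critical window (θ_L just ≥1/L) min-GS κ̃ may jump DOWN by >η_L at level crossings; no continuation tool controls the gapless nodal d-wave GS over a fixed step s.
sources: Scalapino1995, RaghuKivelsonScalapino2010, MatveevLarkin1997, HastingsWen2005, LinHirschScalapino1988, KohnLuttinger1965
[crux] LOCAL CONVEX STEP — BCS convexity of the Cooper coordinate over short coupling steps in the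
incipiently ordered regime (crux-strategist split of CooperCoordinateGrowth, piece V; the card's
convex clause (K) dκ̃/dg ≥ b read one-sidedly): at weak coupling (∃U₀,γ; ∀U∈(0,U₀), δ∈(0,1/2)) there
are a step s>0, a rate b>0, a slack η_L→0 and L₀ such that for even L≥L₀ and −γ≤g₂≤g₃≤0 with
g₃≤g₂+s: IF every normalised sector ground state at every g∈[g₂,g₃] has θ_L ≥ 1/L, THEN for every
normalised sector ground state ψ₃ of H_L(U,g₃) some normalised sector ground state ψ₂ of H_L(U,g₂)
has κ̃(ψ₂) + b(g₃−g₂) ≤ κ̃(ψ₃) + η_L, κ̃ = −1/log(θ_L/64) (BCS: κ̃ ≈ (N_d/2)·g_net is affine in the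
coupling, Raghu–Kivelson–Scalapino). The short-step form is what a continuation argument from the
ordered side proves; by the abstract lemma `telescope` of the assembly file it composes over any
subinterval with slack ⌈length/s⌉·|η_L| (the telescoping is done once, in the glue
CooperCoordinateGrowthOfSubs). g₂=g₃ is consistent with ψ₂:=ψ₃ (η_L≥0). (why it might fail: dκ̃/dg ≥
b is BCS mean-field (κ̃≈N_d·g_net/2); beyond it κ̃ may plateau on part of [−γ,0] (b not uniform); in
the finite-size critical window ( -/
@[route_item "route-HubbardSuperconductivity-CooperSharpness"]
def LocalConvexStep : Prop :=
  ∃ U₀ : ℝ, 0 < U₀ ∧ ∃ γ : ℝ, 0 < γ ∧ ∀ U ∈ Set.Ioo (0:ℝ) U₀, ∀ δ ∈ Set.Ioo (0:ℝ) (1 / 2), ∃ s : ℝ, 0 < s ∧ ∃ b : ℝ, 0 < b ∧ ∃ η : ℕ → ℝ, Filter.Tendsto η Filter.atTop (nhds 0) ∧ ∃ L₀ : ℕ, ∀ (L : ℕ) [NeZero L], L₀ ≤ L → Even L → ∀ g₂ g₃ : ℝ, -γ ≤ g₂ → g₂ ≤ g₃ → g₃ ≤ 0 → g₃ ≤ g₂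 + s → (∀ g : ℝ, g₂ ≤ g → g ≤ g₃ → ∀ ψ : Literature.MathematicalPhysics.QuantumLattice.Fock (Literature.MathematicalPhysics.QuantumLattice.Orb (Literature.MathematicalPhysics.QuantumLattice.FermionTorus 2 L)), star ψ ⬝ᵥ ψ = 1 → Literature.MathematicalPhysics.QuantumLattice.IsGroundStateInSector (Literature.MathematicalPhysics.QuantumLattice.hubbardTorus 2 L 1 U - ((g : ℝ) : ℂ) • (∑ x : Literature.Probability.LatticeModels.TorusSite 2 L, Matrix.conjTranspose (Literature.MathematicalPhysics.QuantumLattice.localPair Literature.MathematicalPhysics.QuantumLattice.dWaveFormFactor L x) * Literature.MathematicalPhysics.QuantumLattice.localPair Literature.MathematicalPhysics.QuantumLattice.dWaveFormFactor L x)) (2 * ⌊(1 - δ) * (L : ℝ) ^ 2 / 2⌋₊) 0 ψ → 1 / (L : ℝ) ≤ ((Literature.MathematicalPhysics.QuantumLattice.expect (Matrix.conjTranspose (Literature.MathematicalPhysics.QuantumLattice.pairField Literature.MathematicalPhysics.QuantumLattice.dWaveFormFactor L) * Literature.MathematicalPhysics.QuantumLattice.pairField Literature.MathematicalPhysics.QuantumLattice.dWaveFormFactor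 L) ψ).re / (L : ℝ) ^ 4)) → ∀ ψ₃ : Literature.MathematicalPhysics.QuantumLattice.Fock (Literature.MathematicalPhysics.QuantumLattice.Orb (Literature.MathematicalPhysics.QuantumLattice.FermionTorus 2 L)), star ψ₃ ⬝ᵥ ψ₃ = 1 → Literature.MathematicalPhysics.QuantumLattice.IsGroundStateInSector (Literature.MathematicalPhysics.QuantumLattice.hubbardTorus 2 L 1 U - ((g₃ : ℝ) : ℂ) • (∑ x : Literature.Probability.LatticeModels.TorusSite 2 L, Matrix.conjTranspose (Literature.MathematicalPhysics.QuantumLattice.localPair Literature.MathematicalPhysics.QuantumLattice.dWaveFormFactor L x) * Literature.MathematicalPhysics.QuantumLattice.localPair Literature.MathematicalPhysics.QuantumLattice.dWaveFormFactor L x)) (2 * ⌊(1 - δ) * (L : ℝ) ^ 2 / 2⌋₊) 0 ψ₃ → ∃ ψ₂ : Literature.MathematicalPhysics.QuantumLattice.Fock (Literature.MathematicalPhysics.QuantumLattice.Orb (Literature.MathematicalPhysics.QuantumLattice.FermionTorus 2 L)), star ψ₂ ⬝ᵥ ψ₂ = 1 ∧ Literature.MathematicalPhysics.QuantumLattice.IsGroundStateInSector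 (Literature.MathematicalPhysics.QuantumLattice.hubbardTorus 2 L 1 U - ((g₂ : ℝ) : ℂ) • (∑ x : Literature.Probability.LatticeModels.TorusSite 2 L, Matrix.conjTranspose (Literature.MathematicalPhysics.QuantumLattice.localPair Literature.MathematicalPhysics.QuantumLattice.dWaveFormFactor L x) * Literature.MathematicalPhysics.QuantumLattice.localPair Literature.MathematicalPhysics.QuantumLattice.dWaveFormFactor L x)) (2 * ⌊(1 - δ) * (L : ℝ) ^ 2 / 2⌋₊) 0 ψ₂ ∧ (-1 / Real.log (((Literature.MathematicalPhysics.QuantumLattice.expect (Matrix.conjTranspose (Literature.MathematicalPhysics.QuantumLattice.pairField Literature.MathematicalPhysics.QuantumLattice.dWaveFormFactor L) * Literature.MathematicalPhysics.QuantumLattice.pairField Literature.MathematicalPhysics.QuantumLattice.dWaveFormFactor L) ψ₂).re / (L : ℝ) ^ 4) / 64)) + b * (g₃ - g₂) ≤ (-1 / Real.log (((Literature.MathematicalPhysics.QuantumLattice.expect (Matrix.conjTranspose (Literature.MathematicalPhysics.QuantumLattice.pairField Literature.MathematicalPhysics.QuantumLattice.dWaveFormFactor L) * Literature.MathematicalPhysics.QuantumLattice.pairField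 Literature.MathematicalPhysics.QuantumLattice.dWaveFormFactor L) ψ₃).re / (L : ℝ) ^ 4) / 64)) + η L

/-- item stmt-HubbardSuperconductivity-12851 · support · rank 9 · closed · proved by Summit.HubbardSuperconductivity.HubbardSuperconductivity.Theorems.CooperSharpness.dichotomyGivesGrowth_proof (prover) · by planner
sources: AizenmanBarsky1987, DuminilCopinTassionCMP2016
[support] the alternative deciding chain, pure logic (proved as `example` in the planner's
Sketch.lean): SharpnessDichotomy gives (U₀, γ); CooperThreshold at (U₀, γ) gives (U, δ, g₀) with the
divergence; SharpnessDichotomy returns b, η, L₀ and the growth law on [g₀/2, 0], which is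
CooperCoordinateGrowth with g₀/2 < 0. [difficulty: provable-now] -/
@[route_item "route-HubbardSuperconductivity-CooperSharpness"]
def DichotomyGivesGrowth : Prop :=
  SharpnessDichotomy → CooperThreshold → CooperCoordinateGrowth

-- `DichotomyGivesGrowth` holds: proved by `Summit.HubbardSuperconductivity.HubbardSuperconductivity.Theorems.CooperSharpness.dichotomyGivesGrowth_proof` (its module imports this route file, so no `_holds` link can be stated here).

/-- item stmt-HubbardSuperconductivity-12852 · support · rank 9 · closed · proved by Summit.HubbardSuperconductivity.HubbardSuperconductivity.Theorems.CooperSharpness.growthGlue_proof @ ebcaf734bfc8 (prover) · by planner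
sources: DuminilCopinTassionCMP2016, Scalapino1995
[support] ONE TELESCOPING (card P0; real-analysis core proved as `example`s in the planner's
Sketch.lean): from the growth law at (U,δ,g₀,b,η,L₀) with g₀ < 0 < b, η_L → 0: for every even L ≥ L₁
(L₁ ≥ L₀ with η_L ≤ b|g₀|/2) and every normalised sector ground state ψ of the PURE model (=
H_L(U,0): rewrite H − ((0:ℝ):ℂ)•K = H), take (g₂,g₃) = (g₀,0), ψ₃ = ψ: some GS ψ₂ at g₀ has κ̃(ψ₂) +
b|g₀| ≤ κ̃(ψ) + η_L; κ̃(ψ₂) ≥ 0 because θ(ψ₂) ∈ [0,32] (pFᴴpF ⪰ 0,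
`pairField_conjTranspose_mul_self_posSemidef`; ‖pF‖² ≤ 32L⁴, `lroSeq_pairFieldCorr_le`) so log(θ/64)
≤ 0; hence κ̃(ψ) ≥ b|g₀|/2 =: c > 0, so log(θ(ψ)/64) ∈ [−1/c, 0) and θ(ψ) ≥ 64·exp(−1/c) =
64·exp(2/(b·g₀)). [difficulty: provable-now] -/
@[route_item "route-HubbardSuperconductivity-CooperSharpness"]
def GrowthGlue : Prop :=
  ∀ (U δ g₀ b : ℝ) (η : ℕ → ℝ) (L₀ : ℕ), g₀ < 0 → 0 < b → Filter.Tendsto η Filter.atTop (nhds 0) → (∀ (L : ℕ) [NeZero L], L₀ ≤ L → Even L → ∀ g₂ g₃ : ℝ, g₀ ≤ g₂ → g₂ ≤ g₃ → g₃ ≤ 0 → ∀ ψ₃ : Literature.MathematicalPhysics.QuantumLattice.Fock (Literature.MathematicalPhysics.QuantumLattice.Orb (Literature.MathematicalPhysics.QuantumLattice.FermionTorus 2 L)), star ψ₃ ⬝ᵥ ψ₃ = 1 → Literature.MathematicalPhysics.QuantumLattice.IsGroundStateInSector (Literature.MathematicalPhysics.QuantumLattice.hubbardTorus 2 L 1 U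 - ((g₃ : ℝ) : ℂ) • (∑ x : Literature.Probability.LatticeModels.TorusSite 2 L, Matrix.conjTranspose (Literature.MathematicalPhysics.QuantumLattice.localPair Literature.MathematicalPhysics.QuantumLattice.dWaveFormFactor L x) * Literature.MathematicalPhysics.QuantumLattice.localPair Literature.MathematicalPhysics.QuantumLattice.dWaveFormFactor L x)) (2 * ⌊(1 - δ) * (L : ℝ) ^ 2 / 2⌋₊) 0 ψ₃ → ∃ ψ₂ : Literature.MathematicalPhysics.QuantumLattice.Fock (Literature.MathematicalPhysics.QuantumLattice.Orb (Literature.MathematicalPhysics.QuantumLattice.FermionTorus 2 L)), star ψ₂ ⬝ᵥ ψ₂ = 1 ∧ Literature.MathematicalPhysics.QuantumLattice.IsGroundStateInSector (Literature.MathematicalPhysics.QuantumLattice.hubbardTorus 2 L 1 U - ((g₂ : ℝ) : ℂ) • (∑ x : Literature.Probability.LatticeModels.TorusSite 2 L, Matrix.conjTranspose (Literature.MathematicalPhysics.QuantumLattice.localPair Literature.MathematicalPhysics.QuantumLattice.dWaveFormFactor L x) * Literature.MathematicalPhysics.QuantumLattice.localPair Literature.MathematicalPhysics.QuantumLattice.dWaveFormFactor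 L x)) (2 * ⌊(1 - δ) * (L : ℝ) ^ 2 / 2⌋₊) 0 ψ₂ ∧ (-1 / Real.log (((Literature.MathematicalPhysics.QuantumLattice.expect (Matrix.conjTranspose (Literature.MathematicalPhysics.QuantumLattice.pairField Literature.MathematicalPhysics.QuantumLattice.dWaveFormFactor L) * Literature.MathematicalPhysics.QuantumLattice.pairField Literature.MathematicalPhysics.QuantumLattice.dWaveFormFactor L) ψ₂).re / (L : ℝ) ^ 4) / 64)) + b * (g₃ - g₂) ≤ (-1 / Real.log (((Literature.MathematicalPhysics.QuantumLattice.expect (Matrix.conjTranspose (Literature.MathematicalPhysics.QuantumLattice.pairField Literature.MathematicalPhysics.QuantumLattice.dWaveFormFactor L) * Literature.MathematicalPhysics.QuantumLattice.pairField Literature.MathematicalPhysics.QuantumLattice.dWaveFormFactor L) ψ₃).re / (L : ℝ) ^ 4) / 64)) + η L) → ∃ L₁ : ℕ, ∀ (L : ℕ) [NeZero L], L₁ ≤ L → Even L → ∀ ψ : Literature.MathematicalPhysics.QuantumLattice.Fock (Literature.MathematicalPhysics.QuantumLattice.Orb (Literature.MathematicalPhysics.QuantumLattice.FermionTorus 2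 L)), star ψ ⬝ᵥ ψ = 1 → Literature.MathematicalPhysics.QuantumLattice.IsGroundStateInSector (Literature.MathematicalPhysics.QuantumLattice.hubbardTorus 2 L 1 U) (2 * ⌊(1 - δ) * (L : ℝ) ^ 2 / 2⌋₊) 0 ψ → 64 * Real.exp (2 / (b * g₀)) ≤ ((Literature.MathematicalPhysics.QuantumLattice.expect (Matrix.conjTranspose (Literature.MathematicalPhysics.QuantumLattice.pairField Literature.MathematicalPhysics.QuantumLattice.dWaveFormFactor L) * Literature.MathematicalPhysics.QuantumLattice.pairField Literature.MathematicalPhysics.QuantumLattice.dWaveFormFactor L) ψ).re / (L : ℝ) ^ 4)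

-- `GrowthGlue` holds: proved by `Summit.HubbardSuperconductivity.HubbardSuperconductivity.Theorems.CooperSharpness.growthGlue_proof` @ ebcaf734bfc8 (its module imports this route file, so no `_holds` link can be stated here).

/-- item stmt-HubbardSuperconductivity-12853 · support · rank 9 · closed · proved by Summit.HubbardSuperconductivity.HubbardSuperconductivity.Theorems.CooperSharpness.floorGivesLRO_proof (prover) · by planner
sources: Scalapino1995, Griffiths1966, Tasaki2020
[support] LIMINF BOOKKEEPING (pattern of Theorems/WeakCouplingBCSWcbcsThesis.lean
`hubbardSuperconductivity_of_evenThesis_half` / TorusCooperLog `PenaltyResponseLRO`): a uniform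
floor m > 0 on the order density θ_L(ψ) = L⁻⁴Re⟨ψ,pFᴴpFψ⟩ of every normalised (N_L,S^z=0)-sector
ground state of hubbardTorus 2 L 1 U at every even L ≥ L₀ implies the summit matrix at (U,δ): for
admissible (N,ψ) the LRO sequence at k ≥ max(L₀,2)/2 equals θ_{2k}(ψ(2k)) (`sum_torusPullback_succ`,
`torusLROSeq_pairFieldCorr_succ`), is eventually ≥ m and bounded by 32 (`lroSeq_pairFieldCorr_le`),
so its real liminf is ≥ m > 0 (`hasTorusLRO_of_eventually_le` pattern). [difficulty: provable-now] -/
@[route_item "route-HubbardSuperconductivity-CooperSharpness"]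
def FloorGivesLRO : Prop :=
  ∀ (U δ m : ℝ) (L₀ : ℕ), 0 < m → (∀ (L : ℕ) [NeZero L], L₀ ≤ L → Even L → ∀ ψ : Literature.MathematicalPhysics.QuantumLattice.Fock (Literature.MathematicalPhysics.QuantumLattice.Orb (Literature.MathematicalPhysics.QuantumLattice.FermionTorus 2 L)), star ψ ⬝ᵥ ψ = 1 → Literature.MathematicalPhysics.QuantumLattice.IsGroundStateInSector (Literature.MathematicalPhysics.QuantumLattice.hubbardTorus 2 L 1 U) (2 * ⌊(1 - δ) * (L : ℝ) ^ 2 / 2⌋₊) 0 ψ → m ≤ ((Literature.MathematicalPhysics.QuantumLattice.expect (Matrix.conjTranspose (Literature.MathematicalPhysics.QuantumLattice.pairField Literature.MathematicalPhysics.QuantumLattice.dWaveFormFactor L) * Literature.MathematicalPhysics.QuantumLattice.pairField Literature.MathematicalPhysics.QuantumLattice.dWaveFormFactor L) ψ).re / (L : ℝ) ^ 4)) → ∀ (N : ℕ → ℕ) (ψ : ∀ L, Literature.MathematicalPhysics.QuantumLattice.Fock (Literature.MathematicalPhysics.QuantumLattice.Orb (Literature.MathematicalPhysics.QuantumLattice.FermionTorus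 2 L))), (∀ L, Even L → N L = (2 * ⌊(1 - δ) * (L : ℝ) ^ 2 / 2⌋₊) ∧ star (ψ L) ⬝ᵥ ψ L = 1 ∧ Literature.MathematicalPhysics.QuantumLattice.IsGroundStateInSector (Literature.MathematicalPhysics.QuantumLattice.hubbardTorus 2 L 1 U) (N L) 0 (ψ L)) → Literature.Probability.LatticeModels.HasLongRangeOrder (fun k => Literature.Probability.LatticeModels.halfOpenBox 2 (2 * k)) (fun k => Literature.MathematicalPhysics.QuantumLattice.torusPullback (Literature.MathematicalPhysics.QuantumLattice.pairFieldCorr Literature.MathematicalPhysics.QuantumLattice.dWaveFormFactor ψ) (2 * k))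

-- `FloorGivesLRO` holds: proved by `Summit.HubbardSuperconductivity.HubbardSuperconductivity.Theorems.CooperSharpness.floorGivesLRO_proof` (its module imports this route file, so no `_holds` link can be stated here).

/-- item stmt-HubbardSuperconductivity-12854 · support · rank 9 · closed · proved by Summit.HubbardSuperconductivity.HubbardSuperconductivity.Theorems.CooperSharpness.twistAveragingBound_proof (prover) · by planner
sources: KomaTasaki1994, Tasaki2019Tower, Griffiths1966, KaplanHorschVonDerLinden1989
[support] WHY THE LOCAL AXIS (card P1; quantitative no-go for per-site mean-field pair penalties,
provable now, serves kac-window-penalty-sandwich / KkFloor K2 / DeformationLadder too): there is a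
universal C such that for all U, h ∈ (0,1], L ≥ L₀(h) and every sector (N, S^z=0): E₀(hubbardTorus 2
L 1 U + (h/L²)·pFᴴpF) ≤ E₀(hubbardTorus 2 L 1 U) + C√h·L. Proof: average the pure sector GS ψ over
gauge twists U_q = exp(iΣ_x (q·x) n_x), q ∈ (2π/L)ℤ², |q|_∞ ≤ ε (U_q preserves the sector; ±q
averaging kills currents): kinetic excess ≤ 4ε²L²; U_qᴴ pF U_q = pair field at momentum 2q, so
Parseval over pair momenta gives avg_q⟨U_qψ, pFᴴpF U_qψ⟩ ≤ 4π²C₂L²/ε² (C₂ ≤ 128); penalty avg ≤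
4π²C₂h/ε²; optimise ε² = π√(C₂h)/L (needs εL ≥ 2π, i.e. L ≥ L₀(h)): excess ≤ 8π√C₂·√h·L. Corollary
(Griffiths): no ground state of the h-penalised model has k=0 pair LRO for any fixed h > 0 — an
extensive penalty makes g = 0 an endpoint, hence the route's LOCAL coupling. [difficulty: M] -/
@[route_item "route-HubbardSuperconductivity-CooperSharpness"]
def TwistAveragingBound : Prop :=
  ∃ C : ℝ, ∀ (U h : ℝ), 0 < h → h ≤ 1 → ∃ L₀ : ℕ, ∀ (L : ℕ) [NeZero L], L₀ ≤ L → ∀ N : ℕ, Matrix.minEnergyOn (Literature.MathematicalPhysics.QuantumLattice.hubbardTorus 2 L 1 U + ((h / (L : ℝ) ^ 2 : ℝ) : ℂ) • (Matrix.conjTranspose (Literature.MathematicalPhysics.QuantumLattice.pairField Literature.MathematicalPhysics.QuantumLattice.dWaveFormFactor L) * Literature.MathematicalPhysics.QuantumLattice.pairField Literature.MathematicalPhysics.QuantumLattice.dWaveFormFactor L)) (Literature.MathematicalPhysics.QuantumLattice.szSector N 0) ≤ Matrix.minEnergyOn (Literature.MathematicalPhysics.QuantumLattice.hubbardTorus 2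 L 1 U) (Literature.MathematicalPhysics.QuantumLattice.szSector N 0) + C * Real.sqrt h * (L : ℝ)

-- `TwistAveragingBound` holds: proved by `Summit.HubbardSuperconductivity.HubbardSuperconductivity.Theorems.CooperSharpness.twistAveragingBound_proof` (its module imports this route file, so no `_holds` link can be stated here).

/-- item stmt-HubbardSuperconductivity-19071 · support · rank 9 · closed · proved by Summit.HubbardSuperconductivity.HubbardSuperconductivity.Theorems.CooperSharpness.cooperCoordinateGrowthOfSubs_proof (prover) · by planner
sources: AizenmanBarsky1987, DuminilCopinTassionCMP2016
[support] GLUE OF THE STRATEGIST SPLIT (BC2 redirect of the deciding crux; pure logic + real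
bookkeeping, PROVED sorry-free — candidate proof attached as evidence:
CooperSharpnessCooperCoordinateGrowthSplit.lean, theorem cooperCoordinateGrowth_of_subs, lean check
rc0, axioms propext/Classical.choice/Quot.sound; also published as
Cruxes/CooperCoordinateGrowth/Lines/split.lean): CooperThreshold gives (U, δ, g₀) and the every-GS
divergence at g₀ inside the common weak-coupling window (U₀ := min, γ := min);
IncipientOrderPropagation with Δ := |g₀|/2 gives incipient order θ_L ≥ 1/L for every GS on [g₀/2, 0]
at L ≥ L₁; LocalConvexStep gives (s, b, η_L, L₀); the one-step relation ∀ψ₃∃ψ₂ is TELESCOPED over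
⌈|g₀|/(2s)⌉ steps of length ≤ s (induction on the number of steps, composing through the
intermediate ground state, slack k·|η_L|), so CooperCoordinateGrowth holds at (U, δ, g₀/2, b, η′_L
:= ⌈|g₀|/(2s)⌉·|η_L| → 0, max L₀ L₁). A prover lands the attached file under Theorems/ and closes
this item with `theorem … : CooperCoordinateGrowthOfSubs := fun hT hR hV =>
cooperCoordinateGrowth_of_subs hT hR hV`. [difficulty: provable-now — proof in hand] [sources:
AizenmanBarsky1987, DuminilCopinTas -/
@[route_item "route-HubbardSuperconductivity-CooperSharpness"]
def CooperCoordinateGrowthOfSubs : Prop :=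
  CooperThreshold → IncipientOrderPropagation → LocalConvexStep → CooperCoordinateGrowth

-- `CooperCoordinateGrowthOfSubs` holds: proved by `Summit.HubbardSuperconductivity.HubbardSuperconductivity.Theorems.CooperSharpness.cooperCoordinateGrowthOfSubs_proof` (its module imports this route file, so no `_holds` link can be stated here).

/-- item stmt-HubbardSuperconductivity-19072 · support · rank 9 · closed · proved by Summit.HubbardSuperconductivity.HubbardSuperconductivity.Theorems.CooperSharpness.sharpnessDichotomyOfSubs_proof (prover) · by planner
sources: AizenmanBarsky1987, DuminilCopinTassionCMP2016
[support] the route's rank-2 crux SharpnessDichotomy is DERIVED from the two new pieces (same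
telescoping core; PROVED sorry-free in the attached CooperSharpnessCooperCoordinateGrowthSplit.lean,
theorem sharpnessDichotomy_of_subs): the divergence hypothesis of SharpnessDichotomy plays the role
of CooperThreshold; IncipientOrderPropagation (Δ := |g₀|/2) + LocalConvexStep telescoped over
⌈|g₀|/(2s)⌉ steps give the growth law on [g₀/2, 0] with slack ⌈|g₀|/(2s)⌉·|η_L| → 0. Informs
staffing: attack IncipientOrderPropagation / LocalConvexStep, not SharpnessDichotomy directly.
[difficulty: provable-now — proof in hand] [sources: AizenmanBarsky1987, DuminilCopinTassionCMP2016] -/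
@[route_item "route-HubbardSuperconductivity-CooperSharpness"]
def SharpnessDichotomyOfSubs : Prop :=
  IncipientOrderPropagation → LocalConvexStep → SharpnessDichotomy

-- `SharpnessDichotomyOfSubs` holds: proved by `Summit.HubbardSuperconductivity.HubbardSuperconductivity.Theorems.CooperSharpness.sharpnessDichotomyOfSubs_proof` (its module imports this route file, so no `_holds` link can be stated here).

/-- item stmt-HubbardSuperconductivity-12855 · assembly · rank 1 · closed · proved by Summit.HubbardSuperconductivity.HubbardSuperconductivity.Theorems.CooperSharpness.assembly_proof @ ae4eb4bf910f (prover) · by planner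
sources: Scalapino1995, ArovasBergKivelsonRaghu2022
[assembly] CooperCoordinateGrowth → GrowthGlue → FloorGivesLRO → HubbardSuperconductivity (pure
logic; the deciding theorem `closes`). -/
@[route_item "route-HubbardSuperconductivity-CooperSharpness"]
def Assembly : Prop :=
  CooperCoordinateGrowth → GrowthGlue → FloorGivesLRO → HubbardSuperconductivity

-- `Assembly` holds: proved by `Summit.HubbardSuperconductivity.HubbardSuperconductivity.Theorems.CooperSharpness.assembly_proof` @ ae4eb4bf910f (its module imports this route file, so no `_holds` link can be stated here).

/-! D-0027 §2.1 — DECIDING THEOREM (planner-authored via `route open/edit --closes-file`; by planner-plancard-HubbardSuperconductivity-Hub-26a64e98-0 2026-08-15T18:56:33Z):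
its hypotheses are this route's items and its conclusion the sub-problem Statement (glue_lint), and it elaborates with this file. -/

@[closes "route-HubbardSuperconductivity-CooperSharpness"] theorem closes (h₁ : CooperCoordinateGrowth) (h₂ : GrowthGlue) (h₃ : FloorGivesLRO) :
    _root_.HubbardSuperconductivity := by
  obtain ⟨U, hU, δ, hδ, g₀, hg₀, b, hb, η, hη, L₀, hK⟩ := h₁
  obtain ⟨L₁, hfloor⟩ := h₂ U δ g₀ b η L₀ hg₀ hb hη hK
  rw [_root_.HubbardSuperconductivity_iff]
  exact ⟨U, hU, δ, hδ, h₃ U δ (64 * Real.exp (2 / (b * g₀))) L₁ (by positivity) hfloor⟩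

end Summit.HubbardSuperconductivity.HubbardSuperconductivity.Theses.CooperSharpness
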